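import Literature.LinearAlgebra.Matrix.SL2ZNormalFormsEnumeration
import Mathlib.Data.ZMod.Basic
import HarnessLib

/-!
# Hertling–Larabi 2026b THEOREMS 7.9/7.10 (c)(i)(ii) as CLASS-NUMBER BOUNDS for integer `2 × 2` matrices with
# non-square discriminant — finitely many `SL₂(ℤ)`-classes, at most `|M(r, s)|` of them, and
# `#GL₂(ℤ)-classes ≤ #SL₂(ℤ)-classes ≤ 2 · #GL₂(ℤ)-classes` — and EXAMPLES 7.21: for the characteristic
# polynomial `t² − 7` «there is only one `GL_2(ℤ)`-conjugacy class of matrices in `M_{2×2}(ℤ)` … and it splits into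
# two `SL_2(ℤ)`-conjugacy classes», `M(0, −7) = {(0 7; 1 0), (0 −7; −1 0), (1 3; 2 −1), (1 −3; −2 −1)}`

[topic LinearAlgebra/Matrix] Sequel to `SL2ZIrreducibleNormalForms` (Thm. 7.10), `GL2ZSL2ZClassSplitting` (Thm. 7.9
(b)(c)) and `SL2ZNormalFormsEnumeration` (`M(r, s)` as a finset `T(r, s)` of pairs `(a, c)`).  Lane `lit-hodgefound`
(Track 2 foundations library), seat p19 generation 39, row g39-#6.  THEOREMS ONLY: no definition, no instance, no
notation, no named fact (D-0026, net Literature debt `0`), no `sorry`.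

Conventions (as in the three predecessors): `B = (a b; c d)`, `a = B 0 0, b = B 0 1, c = B 1 0, d = B 1 1`;
`B ∼_{SL₂(ℤ)} B'` is `∃ γ, det γ = 1 ∧ γ B' = B γ`; `B ∼_{GL₂(ℤ)} B'` is `∃ P, det P ∈ ℤˣ ∧ P B = B' P`; the classes
with characteristic polynomial `t² − rt + s` are the two `Quot`s of `{B // tr B = r ∧ det B = s}`; `M(r, s)` and its
finset of pairs `T(r, s)` are spelled out as in `SL2ZNormalFormsEnumeration`.

## Source, VERBATIM

C. Hertling, K. Larabi, *Conjugacy classes of regular integer matrices*, arXiv:2602.15748 (2026)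
[HertlingLarabi2026b], held `paper:arxiv-2602.15748`, §7.2–7.3 and §7.5, chunks p0016–p0017 and p0023:
«**Theorem 7.9.** Consider an irreducible unitary polynomial `f = t² − rt + s ∈ ℤ[t]` […] (b) Consider the case
`D < 0` […]. Each `GL_2(ℤ)`-conjugacy class of matrices with characteristic polynomial `f` splits into two `SL_2(ℤ)`
conjugacy classes. […] (c) Consider the case `D > 0` […]. The `GL_2(ℤ)`-conjugacy class splits into two
`SL_2(ℤ)`-conjugacy classes if and only if `𝒪(L)` does not contain an invertible element `u` with `N(u) = −1`.»
(before it, §7.2: each `GL₂(ℤ)`-class is a single `SL₂(ℤ)`-class or splits into two — `GL2ZSL2ZClassSplitting.gl_conj_iff`)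
«**Theorem 7.10.** […] (b) The set `M(r, s)` […] is finite and not empty. (c) (i) Each `SL_2(ℤ)`-conjugacy class
of matrices in `M_{2×2}(ℤ)` with characteristic polynomial `f` has representatives in `M(r, s)`. (ii) In the case
of type IV these representatives are called semi-normal forms.»
«**Examples 7.21.** Consider the polynomial `f(t) = t² − rt + s = t² − 7`, so with `r = 0`, `s = −7`,
`D = r²/4 − s = 7 > 0`. It will turn out that there is only one `GL_2(ℤ)`-conjugacy class of matrices in
`M_{2×2}(ℤ)` with characteristic polynomial `f`, and that it splits into two `SL_2(ℤ)`-conjugacy classes. […] But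
first we look at the semi-normal forms in Theorem 7.10 (c)(ii). One sees easily
`M(0, 7) = {(0 7; 1 0), (0 −7; −1 0), (1 3; 2 −1), (1 −3; −2 −1)}`» (sic: with `s = −7` this is the set `M(0, −7)`
of Theorem 7.10 (b)) «[…] But Theorem 7.10 does not say in how many `GL_2(ℤ)` and `SL_2(ℤ)`-conjugacy classes they
lie. To see this, the topograph and the value atlasses are better suited. […] (1) All matrices in `M̃(0, 7)` are in
the two tables. Therefore there is only one `GL_2(ℤ)`-conjugacy class of matrices with characteristic polynomial
`f(t) = t² − 7`.»

## What is proved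

* §1 (every `r, s` with `r² − 4s` not a square — types IV and V): **`finite_quot_sl2_conj`** (finitely many
  `SL₂(ℤ)`-classes), **`natCard_quot_sl2_conj_le_card`** (Theorem 7.10 (c)(i): their number is `≤ |T(r, s)| =
  |M(r, s)|`), **`natCard_quot_gl2_conj_le`** (`#GL₂(ℤ)-classes ≤ #SL₂(ℤ)-classes`), **`natCard_quot_sl2_conj_le_two_mul`**
  (`#SL₂(ℤ)-classes ≤ 2 · #GL₂(ℤ)-classes`: each `GL₂(ℤ)`-class is one or two `SL₂(ℤ)`-classes).
* §2 EXAMPLES 7.21: **`normalForms_zero_neg_seven`** (`M(0, −7)` is the printed four-element set),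
  `sl2_conj_one_three`, `sl2_conj_one_neg_three` (the semi-normal forms `(1 3; 2 −1)`, `(1 −3; −2 −1)` are
  `SL₂(ℤ)`-conjugate to `(0 7; 1 0)` resp. `(0 −7; −1 0)`, explicit conjugators), **`not_sl2_conj_zero_neg_seven`**
  (`(0 7; 1 0)` and `(0 −7; −1 0)` are NOT `SL₂(ℤ)`-conjugate — by Theorem 7.9 (c): a conjugator would give a unit
  `x + y√7` of norm `x² − 7y² = −1`, impossible modulo `4`; the paper reads this off the topograph instead),
  `sl2_conj_or` (every `B` with `tr B = 0`, `det B = −7` is `SL₂(ℤ)`-conjugate to `(0 7; 1 0)` or to `(0 −7; −1 0)`),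
  **`natCard_quot_sl2_conj_zero_neg_seven`** (`= 2`) and **`natCard_quot_gl2_conj_zero_neg_seven`** (`= 1`).
* §3 the non-split case of Theorem 7.9 (c), `t² − 2` (`1 + √2` has norm `−1`): `normalForms_zero_neg_two`
  (`M(0, −2) = {(0 2; 1 0), (0 −2; −1 0)}`), `sl2_conj_zero_neg_two` (these two ARE `SL₂(ℤ)`-conjugate),
  `natCard_quot_sl2_conj_zero_neg_two` (`= 1`), `natCard_quot_gl2_conj_zero_neg_two` (`= 1`).

## References

* [HertlingLarabi2026b] C. Hertling, K. Larabi, arXiv:2602.15748 (2026), §7.2 Theorem 7.9, §7.3 Theorem 7.10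
  (b)(c), §7.5 Examples 7.21 (chunks p0016–p0017, p0023). [cite: HertlingLarabi2026b, §7.2 Theorem 7.9, §7.3 Theorem 7.10 (c), §7.5 Examples 7.21, chunks p0016–p0017, p0023]
-/

namespace Literature.LinearAlgebra.Matrix.SL2ZClassCountNonsquareDiscriminant

open Literature.LinearAlgebra.Matrix.SL2ZIrreducibleNormalForms
open Literature.LinearAlgebra.Matrix.GL2ZSL2ZClassSplitting
open Literature.LinearAlgebra.Matrix.SL2ZNormalFormsEnumeration

/-! ## §0 Two private tools -/

/-- `GL₂(ℤ)`-conjugacy is an equivalence relation on the matrices with a fixed characteristic polynomial.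
[cite: HertlingLarabi2026b, §7.2, chunk p0016] -/
private theorem gl_equivalence (r s : ℤ) :
    Equivalence fun B B' : {B : Matrix (Fin 2) (Fin 2) ℤ // B.trace = r ∧ B.det = s} =>
      ∃ P : Matrix (Fin 2) (Fin 2) ℤ, IsUnit P.det ∧ P * B.1 = B'.1 * P where
  refl B := ⟨1, by rw [Matrix.det_one]; exact isUnit_one, by rw [Matrix.one_mul, Matrix.mul_one]⟩
  symm := by
    rintro B B' ⟨P, hP, h⟩
    refine ⟨P.adjugate, by rw [Matrix.det_adjugate, Fintype.card_fin]; simpa using hP, ?_⟩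
    have h1 : P.det • (B.1 * P.adjugate) = P.det • (P.adjugate * B'.1) := by
      calc P.det • (B.1 * P.adjugate) = P.adjugate * P * B.1 * P.adjugate := by
            rw [Matrix.adjugate_mul, Matrix.smul_mul, Matrix.one_mul, Matrix.smul_mul]
        _ = P.adjugate * (P * B.1) * P.adjugate := by simp only [Matrix.mul_assoc]
        _ = P.adjugate * (B'.1 * P) * P.adjugate := by rw [h]
        _ = P.adjugate * B'.1 * (P * P.adjugate) := by simp only [Matrix.mul_assoc]
        _ = P.det • (P.adjugate * B'.1) := by rw [Matrix.mul_adjugate, Matrix.mul_smul, Matrix.mul_one]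
    rcases Int.isUnit_iff.1 hP with hd | hd <;> rw [hd] at h1
    · rw [one_smul, one_smul] at h1
      exact h1.symm
    · rw [neg_one_smul, neg_one_smul, neg_inj] at h1
      exact h1.symm
  trans := by
    rintro B B' B'' ⟨P, hP, h⟩ ⟨P', hP', h'⟩
    refine ⟨P' * P, by rw [Matrix.det_mul]; exact hP'.mul hP, ?_⟩
    rw [Matrix.mul_assoc, h, ← Matrix.mul_assoc, h', Matrix.mul_assoc]

/-- From `γ B' = B γ` with `det γ = 1`: `γ^{adj} B = B' γ^{adj}` (the inverse conjugation).
[cite: HertlingLarabi2026b, §7.2, chunk p0016] -/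
private theorem adjugate_conj {B B' γ : Matrix (Fin 2) (Fin 2) ℤ} (hγ : γ.det = 1) (h : γ * B' = B * γ) :
    γ.adjugate * B = B' * γ.adjugate := by
  have h1 : γ.adjugate * (γ * B') * γ.adjugate = γ.adjugate * (B * γ) * γ.adjugate := by rw [h]
  rw [← Matrix.mul_assoc, Matrix.adjugate_mul, hγ, one_smul, Matrix.one_mul, Matrix.mul_assoc, Matrix.mul_assoc,
    Matrix.mul_adjugate, hγ, one_smul, Matrix.mul_one] at h1
  exact h1.symm

/-- An integer strictly between two consecutive squares is not a square (used for `28` and `8`). [folklore] -/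
private theorem not_isSquare_of_lt {m : ℤ} (n : ℕ) (h1 : (n : ℤ) ^ 2 < m) (h2 : m < ((n : ℤ) + 1) ^ 2) :
    ¬ IsSquare m := by
  rintro ⟨k, hk⟩
  rw [← sq] at hk
  rw [hk] at h1 h2
  have a1 : |(n : ℤ)| < |k| := sq_lt_sq.1 h1
  have a2 : |k| < |(n : ℤ) + 1| := sq_lt_sq.1 h2
  rw [Nat.abs_cast] at a1
  rw [abs_of_nonneg (by positivity : (0 : ℤ) ≤ (n : ℤ) + 1)] at a2
  rcases lt_abs.1 a1 with h | h <;> obtain ⟨h', h''⟩ := abs_lt.1 a2 <;> omega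

/-! ## §1 Class-number bounds for non-square discriminant (Theorems 7.9, 7.10 (c)(i)(ii)) -/

/-- The (semi-)normal forms `M(r, s)` MAP ONTO the `SL₂(ℤ)`-classes (Theorem 7.10 (c)(i) «each `SL_2(ℤ)`-conjugacy
class […] has representatives in `M(r, s)`»). [cite: HertlingLarabi2026b, §7.3 Theorem 7.10 (c)(i), chunk p0017] -/
private theorem mk_normalForm_surjective {r s : ℤ} (hΔ : ¬ IsSquare (r ^ 2 - 4 * s)) :
    Function.Surjective fun M : ↥{B : Matrix (Fin 2) (Fin 2) ℤ | B.trace = r ∧ B.det = s ∧ B 1 0 ≠ 0 ∧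
        |B 1 0| ≤ |B 0 1| ∧ -|B 1 0| < B 0 0 - B 1 1 ∧ B 0 0 - B 1 1 ≤ |B 1 0| ∧
          (|B 1 0| = |B 0 1| → 0 ≤ B 0 0 - B 1 1)} =>
      Quot.mk (fun B B' : {B : Matrix (Fin 2) (Fin 2) ℤ // B.trace = r ∧ B.det = s} =>
        ∃ γ : Matrix (Fin 2) (Fin 2) ℤ, γ.det = 1 ∧ γ * B'.1 = B.1 * γ) ⟨M.1, M.2.1, M.2.2.1⟩ := by
  intro x
  induction x using Quot.ind with
  | _ B =>
  have hB : ¬ IsSquare (B.1.trace ^ 2 - 4 * B.1.det) := by rw [B.2.1, B.2.2]; exact hΔ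
  obtain ⟨M, hM, hconj⟩ := exists_sl2_conj_mem hB
  rw [B.2.1, B.2.2] at hM
  exact ⟨⟨M, hM⟩, Quot.sound ((equivalence_sl2_conj r s).symm (x := B) (y := ⟨M, hM.1, hM.2.1⟩) hconj)⟩

/-- **Finitely many `SL₂(ℤ)`-classes** of integer `2 × 2` matrices with characteristic polynomial `t² − rt + s`,
`r² − 4s` not a square (Theorem 7.10 (b) «`M(r, s)` is finite» + (c)(i)). [cite: HertlingLarabi2026b, §7.3 Theorem 7.10 (b)(c)(i), chunk p0017] -/
theorem finite_quot_sl2_conj {r s : ℤ} (hΔ : ¬ IsSquare (r ^ 2 - 4 * s)) :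
    Finite (Quot fun B B' : {B : Matrix (Fin 2) (Fin 2) ℤ // B.trace = r ∧ B.det = s} =>
      ∃ γ : Matrix (Fin 2) (Fin 2) ℤ, γ.det = 1 ∧ γ * B'.1 = B.1 * γ) := by
  haveI := (finite_normalForms r s).to_subtype
  exact Finite.of_surjective _ (mk_normalForm_surjective hΔ)

/-- **THEOREM 7.10 (c)(i)(ii), counted: for `r² − 4s` not a square the number of `SL₂(ℤ)`-conjugacy classes with
characteristic polynomial `t² − rt + s` is at most `|M(r, s)| = |T(r, s)|`** (the number of semi-normal forms; with
equality for type V by 7.10 (c)(iii), `SL2ZNormalFormsEnumeration.natCard_quot_sl2_conj_eq_card`).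
[cite: HertlingLarabi2026b, §7.3 Theorem 7.10 (b)(c)(i)(ii), chunk p0017] -/
theorem natCard_quot_sl2_conj_le_card {r s : ℤ} (hΔ : ¬ IsSquare (r ^ 2 - 4 * s)) :
    Nat.card (Quot fun B B' : {B : Matrix (Fin 2) (Fin 2) ℤ // B.trace = r ∧ B.det = s} =>
        ∃ γ : Matrix (Fin 2) (Fin 2) ℤ, γ.det = 1 ∧ γ * B'.1 = B.1 * γ) ≤
      (((Finset.Icc (-(|r ^ 2 - 4 * s| / 3 + |r|)) (|r ^ 2 - 4 * s| / 3 + |r|)) ×ˢ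
          (Finset.Icc (-(|r ^ 2 - 4 * s| / 3)) (|r ^ 2 - 4 * s| / 3))).filter
          (fun p : ℤ × ℤ => p.2 ≠ 0 ∧ p.2 ∣ p.1 * (r - p.1) - s ∧ |p.2| ≤ |(p.1 * (r - p.1) - s) / p.2| ∧
            -|p.2| < 2 * p.1 - r ∧ 2 * p.1 - r ≤ |p.2| ∧
              (|p.2| = |(p.1 * (r - p.1) - s) / p.2| → 0 ≤ 2 * p.1 - r))).card := by
  haveI := (finite_normalForms r s).to_subtype
  rw [← natCard_normalForms_eq_card]
  exact Nat.card_le_card_of_surjective _ (mk_normalForm_surjective hΔ)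

/-- **`#GL₂(ℤ)-classes ≤ #SL₂(ℤ)-classes`** (an `SL₂(ℤ)`-conjugation is a `GL₂(ℤ)`-conjugation), `r² − 4s` not a
square. [cite: HertlingLarabi2026b, §7.2 Theorem 7.9 (b)(c), chunks p0016–p0017] -/
theorem natCard_quot_gl2_conj_le {r s : ℤ} (hΔ : ¬ IsSquare (r ^ 2 - 4 * s)) :
    Nat.card (Quot fun B B' : {B : Matrix (Fin 2) (Fin 2) ℤ // B.trace = r ∧ B.det = s} =>
        ∃ P : Matrix (Fin 2) (Fin 2) ℤ, IsUnit P.det ∧ P * B.1 = B'.1 * P) ≤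
      Nat.card (Quot fun B B' : {B : Matrix (Fin 2) (Fin 2) ℤ // B.trace = r ∧ B.det = s} =>
        ∃ γ : Matrix (Fin 2) (Fin 2) ℤ, γ.det = 1 ∧ γ * B'.1 = B.1 * γ) := by
  haveI := finite_quot_sl2_conj hΔ
  refine Nat.card_le_card_of_surjective
    (Quot.lift (fun B => Quot.mk _ B) fun B B' h => Quot.sound ((gl_conj_iff B.1 B'.1).2 (Or.inl h))) ?_
  intro x
  induction x using Quot.ind with
  | _ B => exact ⟨Quot.mk _ B, rfl⟩

/-- **`#SL₂(ℤ)-classes ≤ 2 · #GL₂(ℤ)-classes`: each `GL₂(ℤ)`-class with characteristic polynomial `t² − rt + s`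
(`r² − 4s` not a square) is a single `SL₂(ℤ)`-class or splits into two** — the class of a representative `B` and the
class of `D_{1,−1} B D_{1,−1} = (a, −b; −c, d)` (Theorem 7.9; `gl_conj_iff`).
[cite: HertlingLarabi2026b, §7.2 Theorem 7.9 (b)(c), chunks p0016–p0017] -/
theorem natCard_quot_sl2_conj_le_two_mul {r s : ℤ} (hΔ : ¬ IsSquare (r ^ 2 - 4 * s)) :
    Nat.card (Quot fun B B' : {B : Matrix (Fin 2) (Fin 2) ℤ // B.trace = r ∧ B.det = s} =>
        ∃ γ : Matrix (Fin 2) (Fin 2) ℤ, γ.det = 1 ∧ γ * B'.1 = B.1 * γ) ≤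
      2 * Nat.card (Quot fun B B' : {B : Matrix (Fin 2) (Fin 2) ℤ // B.trace = r ∧ B.det = s} =>
        ∃ P : Matrix (Fin 2) (Fin 2) ℤ, IsUnit P.det ∧ P * B.1 = B'.1 * P) := by
  set S := {B : Matrix (Fin 2) (Fin 2) ℤ // B.trace = r ∧ B.det = s}
  set rs : S → S → Prop := fun B B' => ∃ γ : Matrix (Fin 2) (Fin 2) ℤ, γ.det = 1 ∧ γ * B'.1 = B.1 * γ
    with hrs
  set rg : S → S → Prop := fun B B' => ∃ P : Matrix (Fin 2) (Fin 2) ℤ, IsUnit P.det ∧ P * B.1 = B'.1 * P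
    with hrg
  haveI : Finite (Quot rs) := finite_quot_sl2_conj hΔ
  have hψ : Function.Surjective
      (Quot.lift (fun B => Quot.mk rg B) fun B B' h => Quot.sound ((gl_conj_iff B.1 B'.1).2 (Or.inl h)) :
        Quot rs → Quot rg) := by
    intro x
    induction x using Quot.ind with
    | _ B => exact ⟨Quot.mk _ B, rfl⟩
  haveI : Finite (Quot rg) := Finite.of_surjective _ hψ
  -- `B ↦ D_{1,−1} B D_{1,−1}` on `S`
  let Dc : S → S := fun B => ⟨!![B.1 0 0, -B.1 0 1; -B.1 1 0, B.1 1 1], by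
    obtain ⟨h1, h2⟩ := trace_D_conj_and_det_D_conj B.1
    exact ⟨h1.trans B.2.1, h2.trans B.2.2⟩⟩
  let χ : Quot rg × Bool → Quot rs := fun p => Quot.mk rs (if p.2 then Dc p.1.out else p.1.out)
  have hχ : Function.Surjective χ := by
    intro x
    induction x using Quot.ind with
    | _ B =>
    set q : Quot rg := Quot.mk rg B with hq
    have hrel : rg q.out B := (gl_equivalence r s).eqvGen_iff.1 (Quot.eqvGen_exact ((Quot.out_eq q).trans hq))
    rcases (gl_conj_iff q.out.1 B.1).1 hrel with h | h
    · exact ⟨(q, false), Quot.sound h⟩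
    · exact ⟨(q, true), Quot.sound h⟩
  calc Nat.card (Quot rs) ≤ Nat.card (Quot rg × Bool) := Nat.card_le_card_of_surjective χ hχ
    _ = 2 * Nat.card (Quot rg) := by
        rw [Nat.card_prod, Nat.card_eq_fintype_card (α := Bool), Fintype.card_bool, mul_comm]

/-! ## §2 EXAMPLES 7.21: characteristic polynomial `t² − 7` -/

/-- **EXAMPLES 7.21: «`M(0, 7) = {(0 7; 1 0), (0 −7; −1 0), (1 3; 2 −1), (1 −3; −2 −1)}`»** (`r = 0`, `s = −7`;
the set `M(0, −7)` of Theorem 7.10 (b), i.e. the semi-normal forms with characteristic polynomial `t² − 7`).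
[cite: HertlingLarabi2026b, §7.5 Examples 7.21, chunk p0023] -/
theorem normalForms_zero_neg_seven :
    {B : Matrix (Fin 2) (Fin 2) ℤ | B.trace = 0 ∧ B.det = -7 ∧ B 1 0 ≠ 0 ∧ |B 1 0| ≤ |B 0 1| ∧
        -|B 1 0| < B 0 0 - B 1 1 ∧ B 0 0 - B 1 1 ≤ |B 1 0| ∧ (|B 1 0| = |B 0 1| → 0 ≤ B 0 0 - B 1 1)} =
      {!![0, 7; 1, 0], !![0, -7; -1, 0], !![1, 3; 2, -1], !![1, -3; -2, -1]} := by
  ext B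
  rw [mem_normalForms_iff 0 (-7) B]
  simp only [Set.mem_insert_iff, Set.mem_singleton_iff]
  constructor
  · rintro ⟨hT, hB⟩
    have key : ∀ p ∈ ((Finset.Icc (-(|(0 : ℤ) ^ 2 - 4 * (-7)| / 3 + |(0 : ℤ)|))
          (|(0 : ℤ) ^ 2 - 4 * (-7)| / 3 + |(0 : ℤ)|)) ×ˢ
          (Finset.Icc (-(|(0 : ℤ) ^ 2 - 4 * (-7)| / 3)) (|(0 : ℤ) ^ 2 - 4 * (-7)| / 3))).filter
          (fun p : ℤ × ℤ => p.2 ≠ 0 ∧ p.2 ∣ p.1 * (0 - p.1) - (-7) ∧ |p.2| ≤ |(p.1 * (0 - p.1) - (-7)) / p.2| ∧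
            -|p.2| < 2 * p.1 - 0 ∧ 2 * p.1 - 0 ≤ |p.2| ∧
              (|p.2| = |(p.1 * (0 - p.1) - (-7)) / p.2| → 0 ≤ 2 * p.1 - 0)),
        p = (0, 1) ∨ p = (0, -1) ∨ p = (1, 2) ∨ p = (1, -2) := by
      decide +kernel
    rcases key _ hT with h | h | h | h <;> obtain ⟨h0, h1⟩ := Prod.mk.inj h <;> rw [hB, h0, h1] <;> decide
  · rintro (rfl | rfl | rfl | rfl) <;> decide +kernel

/-- The semi-normal form `(1 3; 2 −1)` is `SL₂(ℤ)`-conjugate to the companion-type matrix `(0 7; 1 0)`: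
`γ (0 7; 1 0) = (1 3; 2 −1) γ` for `γ = (1 −2; −1 3) ∈ SL₂(ℤ)` (Table 7.2 lists both in the class of `(0 7; 1 0)`).
[cite: HertlingLarabi2026b, §7.5 Examples 7.21 (Table 7.2), chunk p0023] -/
theorem sl2_conj_one_three :
    ∃ γ : Matrix (Fin 2) (Fin 2) ℤ, γ.det = 1 ∧ γ * !![0, 7; 1, 0] = !![1, 3; 2, -1] * γ :=
  ⟨!![1, -2; -1, 3], by rw [Matrix.det_fin_two_of]; norm_num, by
    rw [Matrix.mul_fin_two, Matrix.mul_fin_two]; norm_num⟩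

/-- The semi-normal form `(1 −3; −2 −1)` is `SL₂(ℤ)`-conjugate to `(0 −7; −1 0)`: `γ (0 −7; −1 0) = (1 −3; −2 −1) γ`
for `γ = (1 2; 1 3) ∈ SL₂(ℤ)` (Table 7.3). [cite: HertlingLarabi2026b, §7.5 Examples 7.21 (Table 7.3), chunk p0023] -/
theorem sl2_conj_one_neg_three :
    ∃ γ : Matrix (Fin 2) (Fin 2) ℤ, γ.det = 1 ∧ γ * !![0, -7; -1, 0] = !![1, -3; -2, -1] * γ :=
  ⟨!![1, 2; 1, 3], by rw [Matrix.det_fin_two_of]; norm_num, by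
    rw [Matrix.mul_fin_two, Matrix.mul_fin_two]; norm_num⟩

/-- **`(0 7; 1 0)` and `(0 −7; −1 0) = D_{1,−1} (0 7; 1 0) D_{1,−1}` are NOT `SL₂(ℤ)`-conjugate** («it splits into
two `SL_2(ℤ)`-conjugacy classes»).  By `GL2ZSL2ZClassSplitting.sl_conj_D_iff_exists_comm` (Theorem 7.9 (c)) a
conjugator would be a unimodular `U = x·E₂ + y·(0 7; 1 0)` of determinant `x² − 7y² = −1`, which is impossible
modulo `4` (the paper reads the splitting off Conway's topograph instead).
[cite: HertlingLarabi2026b, §7.2 Theorem 7.9 (c) and §7.5 Examples 7.21, chunks p0016–p0017, p0023] -/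
theorem not_sl2_conj_zero_neg_seven :
    ¬ ∃ γ : Matrix (Fin 2) (Fin 2) ℤ, γ.det = 1 ∧ γ * !![0, -7; -1, 0] = !![0, 7; 1, 0] * γ := by
  intro h
  have e : (!![0, -7; -1, 0] : Matrix (Fin 2) (Fin 2) ℤ) =
      !![(!![0, 7; 1, 0] : Matrix (Fin 2) (Fin 2) ℤ) 0 0, -(!![0, 7; 1, 0] : Matrix (Fin 2) (Fin 2) ℤ) 0 1;
        -(!![0, 7; 1, 0] : Matrix (Fin 2) (Fin 2) ℤ) 1 0, (!![0, 7; 1, 0] : Matrix (Fin 2) (Fin 2) ℤ) 1 1] := by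
    decide
  rw [e] at h
  obtain ⟨U, hU, hc⟩ := (sl_conj_D_iff_exists_comm _).1 h
  have h00 := congr_fun (congr_fun hc 0) 0
  have h01 := congr_fun (congr_fun hc 0) 1
  simp only [Matrix.mul_apply, Fin.sum_univ_two, Matrix.of_apply, Matrix.cons_val', Matrix.cons_val_zero,
    Matrix.cons_val_one, Matrix.cons_val_fin_one, Matrix.empty_val'] at h00 h01
  have e1 : U 0 1 = 7 * U 1 0 := by linarith
  have e2 : U 1 1 = U 0 0 := by linarith
  rw [Matrix.det_fin_two, e1, e2] at hU
  have h4 : ∀ x y : ZMod 4, x * x - 7 * y * y ≠ -1 := by decide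
  refine h4 (U 0 0) (U 1 0) ?_
  have := congrArg (Int.cast : ℤ → ZMod 4) hU
  push_cast at this
  linear_combination this

/-- Every integer matrix with characteristic polynomial `t² − 7` is `SL₂(ℤ)`-conjugate to `(0 7; 1 0)` or to
`(0 −7; −1 0)` (Theorem 7.10 (c)(i) + the list `M(0, −7)` + the two conjugations above).
[cite: HertlingLarabi2026b, §7.3 Theorem 7.10 (c)(i) and §7.5 Examples 7.21, chunks p0017, p0023] -/
theorem sl2_conj_or {B : Matrix (Fin 2) (Fin 2) ℤ} (htr : B.trace = 0) (hdet : B.det = -7) :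
    (∃ γ : Matrix (Fin 2) (Fin 2) ℤ, γ.det = 1 ∧ γ * !![0, 7; 1, 0] = B * γ) ∨
      ∃ γ : Matrix (Fin 2) (Fin 2) ℤ, γ.det = 1 ∧ γ * !![0, -7; -1, 0] = B * γ := by
  have hB : ¬ IsSquare (B.trace ^ 2 - 4 * B.det) := by
    rw [htr, hdet]; exact not_isSquare_of_lt 5 (by norm_num) (by norm_num)
  obtain ⟨M, hM, γ, hγ, hconj⟩ := exists_sl2_conj_mem hB
  rw [htr, hdet, normalForms_zero_neg_seven] at hM
  simp only [Set.mem_insert_iff, Set.mem_singleton_iff] at hM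
  rcases hM with rfl | rfl | rfl | rfl
  · exact Or.inl ⟨γ, hγ, hconj⟩
  · exact Or.inr ⟨γ, hγ, hconj⟩
  · obtain ⟨γ', hγ', h'⟩ := sl2_conj_one_three
    refine Or.inl ⟨γ * γ', by rw [Matrix.det_mul, hγ, hγ', mul_one], ?_⟩
    rw [Matrix.mul_assoc, h', ← Matrix.mul_assoc, hconj, Matrix.mul_assoc]
  · obtain ⟨γ', hγ', h'⟩ := sl2_conj_one_neg_three
    refine Or.inr ⟨γ * γ', by rw [Matrix.det_mul, hγ, hγ', mul_one], ?_⟩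
    rw [Matrix.mul_assoc, h', ← Matrix.mul_assoc, hconj, Matrix.mul_assoc]

/-- **EXAMPLES 7.21: exactly TWO `SL₂(ℤ)`-conjugacy classes of integer matrices with characteristic polynomial
`t² − 7`** (those of `(0 7; 1 0)` and `(0 −7; −1 0)`). [cite: HertlingLarabi2026b, §7.5 Examples 7.21, chunk p0023] -/
theorem natCard_quot_sl2_conj_zero_neg_seven :
    Nat.card (Quot fun B B' : {B : Matrix (Fin 2) (Fin 2) ℤ // B.trace = 0 ∧ B.det = -7} =>
        ∃ γ : Matrix (Fin 2) (Fin 2) ℤ, γ.det = 1 ∧ γ * B'.1 = B.1 * γ) = 2 := by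
  have h₁ : (!![0, 7; 1, 0] : Matrix (Fin 2) (Fin 2) ℤ).trace = 0 ∧
      (!![0, 7; 1, 0] : Matrix (Fin 2) (Fin 2) ℤ).det = -7 := by
    rw [Matrix.trace_fin_two_of, Matrix.det_fin_two_of]; norm_num
  have h₂ : (!![0, -7; -1, 0] : Matrix (Fin 2) (Fin 2) ℤ).trace = 0 ∧
      (!![0, -7; -1, 0] : Matrix (Fin 2) (Fin 2) ℤ).det = -7 := by
    rw [Matrix.trace_fin_two_of, Matrix.det_fin_two_of]; norm_num
  rw [Nat.card_eq_two_iff]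
  refine ⟨Quot.mk _ ⟨_, h₁⟩, Quot.mk _ ⟨_, h₂⟩, fun h => ?_, ?_⟩
  · exact not_sl2_conj_zero_neg_seven ((equivalence_sl2_conj 0 (-7)).eqvGen_iff.1 (Quot.eqvGen_exact h))
  · rw [Set.eq_univ_iff_forall]
    intro x
    induction x using Quot.ind with
    | _ B =>
    simp only [Set.mem_insert_iff, Set.mem_singleton_iff]
    rcases sl2_conj_or B.2.1 B.2.2 with h | h
    · exact Or.inl (Quot.sound h)
    · exact Or.inr (Quot.sound h)

/-- **EXAMPLES 7.21: «there is only one `GL_2(ℤ)`-conjugacy class of matrices in `M_{2×2}(ℤ)` with characteristic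
polynomial `f(t) = t² − 7`»** (the two `SL₂(ℤ)`-classes are swapped by `D_{1,−1}`).
[cite: HertlingLarabi2026b, §7.5 Examples 7.21, chunk p0023] -/
theorem natCard_quot_gl2_conj_zero_neg_seven :
    Nat.card (Quot fun B B' : {B : Matrix (Fin 2) (Fin 2) ℤ // B.trace = 0 ∧ B.det = -7} =>
        ∃ P : Matrix (Fin 2) (Fin 2) ℤ, IsUnit P.det ∧ P * B.1 = B'.1 * P) = 1 := by
  have h₁ : (!![0, 7; 1, 0] : Matrix (Fin 2) (Fin 2) ℤ).trace = 0 ∧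
      (!![0, 7; 1, 0] : Matrix (Fin 2) (Fin 2) ℤ).det = -7 := by
    rw [Matrix.trace_fin_two_of, Matrix.det_fin_two_of]; norm_num
  rw [Nat.card_eq_one_iff_exists]
  refine ⟨Quot.mk _ ⟨_, h₁⟩, fun x => ?_⟩
  induction x using Quot.ind with
  | _ B =>
  apply Quot.sound
  rcases sl2_conj_or B.2.1 B.2.2 with ⟨γ, hγ, h⟩ | ⟨γ, hγ, h⟩
  · exact ⟨γ.adjugate, by rw [Matrix.det_adjugate, Fintype.card_fin, hγ, one_pow]; exact isUnit_one,
      adjugate_conj hγ h⟩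
  · refine ⟨!![1, 0; 0, -1] * γ.adjugate, ?_, ?_⟩
    · rw [Matrix.det_mul, Matrix.det_adjugate, Fintype.card_fin, hγ, one_pow, mul_one, Matrix.det_fin_two_of]
      norm_num
    · have hD : (!![1, 0; 0, -1] : Matrix (Fin 2) (Fin 2) ℤ) * !![0, -7; -1, 0] = !![0, 7; 1, 0] * !![1, 0; 0, -1] := by
        rw [Matrix.mul_fin_two, Matrix.mul_fin_two]; norm_num
      rw [Matrix.mul_assoc, adjugate_conj hγ h, ← Matrix.mul_assoc, hD, Matrix.mul_assoc]

/-! ## §3 The non-split case of Theorem 7.9 (c): characteristic polynomial `t² − 2` -/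

/-- `M(0, −2) = {(0 2; 1 0), (0 −2; −1 0)}`: the semi-normal forms with characteristic polynomial `t² − 2`.
[cite: HertlingLarabi2026b, §7.3 Theorem 7.10 (b)(c)(ii), chunk p0017] -/
theorem normalForms_zero_neg_two :
    {B : Matrix (Fin 2) (Fin 2) ℤ | B.trace = 0 ∧ B.det = -2 ∧ B 1 0 ≠ 0 ∧ |B 1 0| ≤ |B 0 1| ∧
        -|B 1 0| < B 0 0 - B 1 1 ∧ B 0 0 - B 1 1 ≤ |B 1 0| ∧ (|B 1 0| = |B 0 1| → 0 ≤ B 0 0 - B 1 1)} =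
      {!![0, 2; 1, 0], !![0, -2; -1, 0]} := by
  ext B
  rw [mem_normalForms_iff 0 (-2) B]
  simp only [Set.mem_insert_iff, Set.mem_singleton_iff]
  constructor
  · rintro ⟨hT, hB⟩
    have key : ∀ p ∈ ((Finset.Icc (-(|(0 : ℤ) ^ 2 - 4 * (-2)| / 3 + |(0 : ℤ)|))
          (|(0 : ℤ) ^ 2 - 4 * (-2)| / 3 + |(0 : ℤ)|)) ×ˢ
          (Finset.Icc (-(|(0 : ℤ) ^ 2 - 4 * (-2)| / 3)) (|(0 : ℤ) ^ 2 - 4 * (-2)| / 3))).filter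
          (fun p : ℤ × ℤ => p.2 ≠ 0 ∧ p.2 ∣ p.1 * (0 - p.1) - (-2) ∧ |p.2| ≤ |(p.1 * (0 - p.1) - (-2)) / p.2| ∧
            -|p.2| < 2 * p.1 - 0 ∧ 2 * p.1 - 0 ≤ |p.2| ∧
              (|p.2| = |(p.1 * (0 - p.1) - (-2)) / p.2| → 0 ≤ 2 * p.1 - 0)),
        p = (0, 1) ∨ p = (0, -1) := by
      decide +kernel
    rcases key _ hT with h | h <;> obtain ⟨h0, h1⟩ := Prod.mk.inj h <;> rw [hB, h0, h1] <;> decide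
  · rintro (rfl | rfl) <;> decide +kernel

/-- **The two semi-normal forms of `t² − 2` ARE `SL₂(ℤ)`-conjugate**: `γ (0 −2; −1 0) = (0 2; 1 0) γ` for
`γ = (1 −2; 1 −1) = U D_{1,−1}` with `U = E₂ + (0 2; 1 0)` the unit `1 + √2` of norm `−1` — the non-split case of
Theorem 7.9 (c). [cite: HertlingLarabi2026b, §7.2 Theorem 7.9 (c), chunks p0016–p0017] -/
theorem sl2_conj_zero_neg_two :
    ∃ γ : Matrix (Fin 2) (Fin 2) ℤ, γ.det = 1 ∧ γ * !![0, -2; -1, 0] = !![0, 2; 1, 0] * γ :=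
  ⟨!![1, -2; 1, -1], by rw [Matrix.det_fin_two_of]; norm_num, by
    rw [Matrix.mul_fin_two, Matrix.mul_fin_two]; norm_num⟩

/-- Every integer matrix with characteristic polynomial `t² − 2` is `SL₂(ℤ)`-conjugate to `(0 2; 1 0)`.
[cite: HertlingLarabi2026b, §7.2 Theorem 7.9 (c) and §7.3 Theorem 7.10 (c)(i), chunks p0016–p0017] -/
theorem sl2_conj_of_zero_neg_two {B : Matrix (Fin 2) (Fin 2) ℤ} (htr : B.trace = 0) (hdet : B.det = -2) :
    ∃ γ : Matrix (Fin 2) (Fin 2) ℤ, γ.det = 1 ∧ γ * !![0, 2; 1, 0] = B * γ := by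
  have hB : ¬ IsSquare (B.trace ^ 2 - 4 * B.det) := by
    rw [htr, hdet]; exact not_isSquare_of_lt 2 (by norm_num) (by norm_num)
  obtain ⟨M, hM, γ, hγ, hconj⟩ := exists_sl2_conj_mem hB
  rw [htr, hdet, normalForms_zero_neg_two] at hM
  simp only [Set.mem_insert_iff, Set.mem_singleton_iff] at hM
  rcases hM with rfl | rfl
  · exact ⟨γ, hγ, hconj⟩
  · obtain ⟨γ', hγ', h'⟩ := sl2_conj_zero_neg_two
    -- `γ'^{adj} (0 2; 1 0) = (0 −2; −1 0) γ'^{adj}`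
    refine ⟨γ * γ'.adjugate, by rw [Matrix.det_mul, Matrix.det_adjugate, Fintype.card_fin, hγ, hγ']; norm_num, ?_⟩
    rw [Matrix.mul_assoc, adjugate_conj hγ' h', ← Matrix.mul_assoc, hconj, Matrix.mul_assoc]

/-- **ONE `SL₂(ℤ)`-conjugacy class of integer matrices with characteristic polynomial `t² − 2`** (the
`GL₂(ℤ)`-class does not split: `ℤ[√2]` has the unit `1 + √2` of norm `−1`, Theorem 7.9 (c)).
[cite: HertlingLarabi2026b, §7.2 Theorem 7.9 (c), chunks p0016–p0017] -/
theorem natCard_quot_sl2_conj_zero_neg_two :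
    Nat.card (Quot fun B B' : {B : Matrix (Fin 2) (Fin 2) ℤ // B.trace = 0 ∧ B.det = -2} =>
        ∃ γ : Matrix (Fin 2) (Fin 2) ℤ, γ.det = 1 ∧ γ * B'.1 = B.1 * γ) = 1 := by
  have h₁ : (!![0, 2; 1, 0] : Matrix (Fin 2) (Fin 2) ℤ).trace = 0 ∧
      (!![0, 2; 1, 0] : Matrix (Fin 2) (Fin 2) ℤ).det = -2 := by
    rw [Matrix.trace_fin_two_of, Matrix.det_fin_two_of]; norm_num
  rw [Nat.card_eq_one_iff_exists]
  refine ⟨Quot.mk _ ⟨_, h₁⟩, fun x => ?_⟩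
  induction x using Quot.ind with
  | _ B => exact Quot.sound (sl2_conj_of_zero_neg_two B.2.1 B.2.2)

/-- **ONE `GL₂(ℤ)`-conjugacy class of integer matrices with characteristic polynomial `t² − 2`.**
[cite: HertlingLarabi2026b, §7.2 Theorem 7.9 (c), chunks p0016–p0017] -/
theorem natCard_quot_gl2_conj_zero_neg_two :
    Nat.card (Quot fun B B' : {B : Matrix (Fin 2) (Fin 2) ℤ // B.trace = 0 ∧ B.det = -2} =>
        ∃ P : Matrix (Fin 2) (Fin 2) ℤ, IsUnit P.det ∧ P * B.1 = B'.1 * P) = 1 := by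
  have h₁ : (!![0, 2; 1, 0] : Matrix (Fin 2) (Fin 2) ℤ).trace = 0 ∧
      (!![0, 2; 1, 0] : Matrix (Fin 2) (Fin 2) ℤ).det = -2 := by
    rw [Matrix.trace_fin_two_of, Matrix.det_fin_two_of]; norm_num
  rw [Nat.card_eq_one_iff_exists]
  refine ⟨Quot.mk _ ⟨_, h₁⟩, fun x => ?_⟩
  induction x using Quot.ind with
  | _ B =>
  obtain ⟨γ, hγ, h⟩ := sl2_conj_of_zero_neg_two B.2.1 B.2.2
  exact Quot.sound ⟨γ.adjugate, by rw [Matrix.det_adjugate, Fintype.card_fin, hγ, one_pow]; exact isUnit_one,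
    adjugate_conj hγ h⟩

end Literature.LinearAlgebra.Matrix.SL2ZClassCountNonsquareDiscriminant
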